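import Literature.Analysis.PDE.SymmetricHyperbolicEnergy
import Mathlib.Analysis.InnerProductSpace.Calculus
import Mathlib.MeasureTheory.Integral.Prod
import Mathlib.Analysis.SpecialFunctions.Integrals.Basic
import Mathlib.Topology.Algebra.Order.Floor
import HarnessLib

/-!
# Uniqueness of finite-energy classical solutions of linear symmetric hyperbolic systems
# (topic `Analysis/PDE`)

Analytic layer of the energy-method theory for linear first-order symmetric hyperbolic systems
(Friedrichs 1954), built to discharge the named fact
`Literature.Geometry.Lorentzian.KerrSchild.waveCauchyProblem` (it is used there to propagate the
constraints of the first-order reduction of the wave equation). For symmetric coefficients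
admissible of order `0` on time slabs and jointly continuous, a classical solution `V` of
`∂ₜV = Σⱼ Aⱼ(t) ∂ⱼV + B(t)V` — smooth in space, with `V` and `∂ⱼV` jointly continuous, the
equation holding pointwise, and the `H¹` energy bounded on time slabs — with `V(0) = 0` vanishes
identically (`eq_zero_of_isEnergySol`): `e(t) = ‖V(t)‖₂² = ∫₀ᵗ 2∫⟪V, 𝒫V⟫` (pointwise fundamental
theorem of calculus and Fubini), `|2∫⟪V, 𝒫V⟫| ≤ K e` (the energy inequality of order `0`,
`abs_integral_inner_cwd_foOp_le`), and the integral form of Grönwall's lemma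
(`e ≤ C (Kt)ⁿ/n! → 0`); negative times by time reversal (Friedrichs 1954, §2; Lax 2006, §6.2).

Everything is proved; no named fact and no `sorry` is introduced.

## References

* K. O. Friedrichs, *Symmetric hyperbolic linear differential equations*, Comm. Pure Appl. Math.
  7 (1954) 345–392, §2 (the energy inequality and uniqueness). [Friedrichs1954]
* P. D. Lax, *Hyperbolic Partial Differential Equations*, Courant Lecture Notes 14, AMS 2006,
  §6.2. [Lax2006]
-/

noncomputable section

open MeasureTheory Set Function Filter intervalIntegral
open scoped ContDiff Topology RealInnerProductSpace ENNReal NNReal Nat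

namespace Literature.Analysis.PDE

variable {ι : Type*} [Fintype ι] [DecidableEq ι]
variable {W : Type*} [NormedAddCommGroup W] [InnerProductSpace ℝ W]

/-! ### Small tools -/

omit [DecidableEq ι] in
/-- The only word of length `≤ 0` is the empty word. [folklore] -/
theorem wordsLE_zero [DecidableEq ι] : wordsLE ι 0 = {[]} := by
  ext v
  rw [mem_wordsLE, Finset.mem_singleton, Nat.le_zero, List.length_eq_zero_iff]

/-- `ℰ₀(U) = ‖U‖₂²`. [folklore] -/
theorem wordEnergy_zero (U : EuclideanSpace ℝ ι → W) : wordEnergy 0 U = l2norm U ^ 2 := by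
  unfold wordEnergy
  rw [wordsLE_zero, Finset.sum_singleton, cwd_nil]

omit [DecidableEq ι] [InnerProductSpace ℝ W] in
/-- `∫ ‖f‖² = ‖f‖₂²` for `f ∈ L²`. [folklore] -/
theorem integral_norm_sq_eq_l2norm_sq {f : EuclideanSpace ℝ ι → W}
    (hf : MemLp f 2 (volume : Measure (EuclideanSpace ℝ ι))) :
    ∫ x, ‖f x‖ ^ 2 = l2norm f ^ 2 := by
  have h1 := hf.eLpNorm_eq_integral_rpow_norm two_ne_zero ENNReal.ofNat_ne_top
  simp only [ENNReal.toReal_ofNat, Real.rpow_two] at h1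
  have hnn : 0 ≤ ∫ x, ‖f x‖ ^ 2 := integral_nonneg fun x ↦ sq_nonneg _
  rw [l2norm_def, h1, ENNReal.toReal_ofReal (Real.rpow_nonneg hnn _)]
  conv_rhs => rw [← Real.rpow_natCast, ← Real.rpow_mul hnn]
  norm_num

omit [DecidableEq ι] [InnerProductSpace ℝ W] in
/-- `∫ ‖f‖ₑ² = ofReal ‖f‖₂²` for `f ∈ L²`. [folklore] -/
theorem lintegral_enorm_sq_eq_ofReal_l2norm_sq {f : EuclideanSpace ℝ ι → W}
    (hf : MemLp f 2 (volume : Measure (EuclideanSpace ℝ ι))) :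
    ∫⁻ x, ‖f x‖ₑ ^ 2 = ENNReal.ofReal (l2norm f ^ 2) := by
  have h1 : ∫⁻ x, ‖f x‖ₑ ^ 2 = eLpNorm f 2 (volume : Measure (EuclideanSpace ℝ ι)) ^ 2 := by
    rw [eLpNorm_eq_lintegral_rpow_enorm_toReal (by norm_num) (by norm_num)]
    simp only [ENNReal.toReal_ofNat]
    rw [← ENNReal.rpow_natCast, ← ENNReal.rpow_mul]
    norm_num
  rw [h1, eLpNorm_eq_ofReal_l2norm hf, ← ENNReal.ofReal_pow (l2norm_nonneg _)]

omit [DecidableEq ι] in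
/-- `𝒫` is linear in the coefficients: `−𝒫_{A,B} U = 𝒫_{−A,−B} U`. [folklore] -/
theorem foOp_neg_coeff (A : ι → EuclideanSpace ℝ ι → (W →L[ℝ] W)) (B : EuclideanSpace ℝ ι → (W →L[ℝ] W))
    (U : EuclideanSpace ℝ ι → W) (x : EuclideanSpace ℝ ι) :
    -foOp A B U x = foOp (fun j y ↦ -A j y) (fun y ↦ -B y) U x := by
  simp only [foOp_apply, _root_.neg_apply, Finset.sum_neg_distrib, neg_add]

omit [DecidableEq ι] in
/-- Admissibility is preserved by negating the coefficients. [folklore] -/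
theorem IsSymmCoeff.neg {k : ℕ} {M : ℝ} {A : ι → EuclideanSpace ℝ ι → (W →L[ℝ] W)}
    {B : EuclideanSpace ℝ ι → (W →L[ℝ] W)} (h : IsSymmCoeff k M A B) :
    IsSymmCoeff k M (fun j y ↦ -A j y) (fun y ↦ -B y) where
  smoothA j := (h.smoothA j).neg
  smoothB := h.smoothB.neg
  symm j x u w := by simp [inner_neg_left, inner_neg_right, h.symm j x u w]
  boundA j v hv x := by
    rw [show (fun y ↦ -A j y) = fun y ↦ -(A j) y from rfl, cwd_neg (h.smoothA j), norm_neg]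
    exact h.boundA j v hv x
  boundB v hv x := by
    rw [show (fun y ↦ -B y) = fun y ↦ -(B) y from rfl, cwd_neg h.smoothB, norm_neg]
    exact h.boundB v hv x

/-! ### Finite-energy classical solutions -/

section Sol

variable (A : ι → ℝ → EuclideanSpace ℝ ι → (W →L[ℝ] W)) (B : ℝ → EuclideanSpace ℝ ι → (W →L[ℝ] W))

/-- **A finite-energy classical solution** of `∂ₜV = Σⱼ Aⱼ(t)∂ⱼV + B(t)V`: smooth in space, `V` and
its first word derivatives jointly continuous, the equation holding pointwise, and the `H¹` energy
finite at every time and bounded on time slabs. [cite: Friedrichs1954, §2] -/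
structure IsEnergySol (V : ℝ → EuclideanSpace ℝ ι → W) : Prop where
  /-- Smoothness in space. -/
  smooth : ∀ t, ContDiff ℝ ∞ (V t)
  /-- Joint continuity of `V` and `∂ⱼV`. -/
  continuous_cwd : ∀ v : List ι, v.length ≤ 1 → Continuous fun p : ℝ × EuclideanSpace ℝ ι ↦ cwd v (V p.1) p.2
  /-- The equation, pointwise. -/
  hasDerivAt : ∀ (t : ℝ) (x : EuclideanSpace ℝ ι),
    HasDerivAt (fun s ↦ V s x) (foOp (fun j ↦ A j t) (B t) (V t) x) t
  /-- `V(t) ∈ H¹` for every `t`. -/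
  isHkSmooth : ∀ t, IsHkSmooth 1 (V t)
  /-- The `H¹` energy is bounded on time slabs. -/
  energy_bdd : ∀ T : ℝ, ∃ C : ℝ, ∀ t ∈ Icc (-T) T, wordEnergy 1 (V t) ≤ C

variable {A B}

/-- Time reversal of a finite-energy classical solution. [folklore] -/
theorem IsEnergySol.reverse {V : ℝ → EuclideanSpace ℝ ι → W} (hV : IsEnergySol A B V) :
    IsEnergySol (fun j s y ↦ -A j (-s) y) (fun s y ↦ -B (-s) y) (fun s ↦ V (-s)) where
  smooth t := hV.smooth (-t)
  continuous_cwd v hv := (hV.continuous_cwd v hv).comp (continuous_fst.neg.prodMk continuous_snd)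
  hasDerivAt t x := by
    have h1 := (hV.hasDerivAt (-t) x).scomp t (hasDerivAt_neg t)
    have h2 : (-1 : ℝ) • foOp (fun j ↦ A j (-t)) (B (-t)) (V (-t)) x =
        foOp (fun j y ↦ -A j (-t) y) (fun y ↦ -B (-t) y) (V (-t)) x := by
      rw [neg_one_smul, foOp_neg_coeff]
    rw [h2] at h1
    exact h1
  isHkSmooth t := hV.isHkSmooth (-t)
  energy_bdd T := by
    obtain ⟨C, hC⟩ := hV.energy_bdd T
    exact ⟨C, fun t ht ↦ hC (-t) ⟨by linarith [ht.2], by linarith [ht.1]⟩⟩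

end Sol

/-! ### The energy argument for nonnegative times -/

section Forward

variable {A : ι → ℝ → EuclideanSpace ℝ ι → (W →L[ℝ] W)} {B : ℝ → EuclideanSpace ℝ ι → (W →L[ℝ] W)}
variable {V : ℝ → EuclideanSpace ℝ ι → W}

/-- **Uniqueness, forward in time**: under the hypotheses of `eq_zero_of_isEnergySol`,
`V(t) = 0` for `t ≥ 0`. [cite: Friedrichs1954, §2] -/
theorem eq_zero_of_isEnergySol_of_nonneg
    (hcoeff : ∀ T : ℝ, ∃ M : ℝ, ∀ t ∈ Icc (-T) T, IsSymmCoeff 0 M (fun j ↦ A j t) (B t))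
    (hAc : ∀ j, Continuous fun p : ℝ × EuclideanSpace ℝ ι ↦ A j p.1 p.2)
    (hBc : Continuous fun p : ℝ × EuclideanSpace ℝ ι ↦ B p.1 p.2)
    (hV : IsEnergySol A B V) (h0 : ∀ x, V 0 x = 0) {t : ℝ} (ht : 0 ≤ t) (x : EuclideanSpace ℝ ι) :
    V t x = 0 := by
  -- constants on the slab `[-T, T]`, `T = t + 1`
  set T : ℝ := t + 1 with hT
  have hT0 : 0 < T := by linarith
  obtain ⟨M, hM⟩ := hcoeff T
  obtain ⟨CE, hCE⟩ := hV.energy_bdd T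
  have hM0 : 0 ≤ M := (hM 0 ⟨by linarith, hT0.le⟩).nonneg
  have hCE0 : 0 ≤ CE := (wordEnergy_nonneg 1 _).trans (hCE 0 ⟨by linarith, hT0.le⟩)
  -- the right-hand side field and the integrand
  set P : ℝ → EuclideanSpace ℝ ι → W := fun s y ↦ foOp (fun j ↦ A j s) (B s) (V s) y with hP
  set F : ℝ → EuclideanSpace ℝ ι → ℝ := fun s y ↦ 2 * ⟪V s y, P s y⟫ with hF
  have hVcont : Continuous fun p : ℝ × EuclideanSpace ℝ ι ↦ V p.1 p.2 := by
    simpa [cwd_nil] using hV.continuous_cwd [] (by simp)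
  have hPcont : Continuous fun p : ℝ × EuclideanSpace ℝ ι ↦ P p.1 p.2 := by
    have heq : (fun p : ℝ × EuclideanSpace ℝ ι ↦ P p.1 p.2) = fun p ↦
        (∑ j, A j p.1 p.2 (cwd [j] (V p.1) p.2)) + B p.1 p.2 (V p.1 p.2) := by
      funext p; rfl
    rw [heq]
    exact (continuous_finsetSum _ fun j _ ↦ (hAc j).clm_apply (hV.continuous_cwd [j] (by simp))).add
      (hBc.clm_apply hVcont)
  have hFcont : Continuous fun p : ℝ × EuclideanSpace ℝ ι ↦ F p.1 p.2 :=
    continuous_const.mul (hVcont.inner hPcont)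
  -- `L²` facts at each time of the slab
  have hVmem : ∀ s, MemLp (V s) 2 (volume : Measure (EuclideanSpace ℝ ι)) := fun s ↦ by
    simpa [cwd_nil] using (hV.isHkSmooth s).memLp [] (by simp)
  have hPmem : ∀ s ∈ Icc (-T) T, MemLp (P s) 2 (volume : Measure (EuclideanSpace ℝ ι)) ∧
      l2norm (P s) ≤ (Fintype.card ι + 1) * M * Real.sqrt CE := by
    intro s hs
    obtain ⟨h1, h2⟩ := memLp_cwd_foOp_and_l2norm_le (hM s hs) (hV.isHkSmooth s) (v := []) le_rfl
    simp only [cwd_nil, pow_zero, mul_one] at h1 h2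
    refine ⟨h1, h2.trans ?_⟩
    exact mul_le_mul_of_nonneg_left (Real.sqrt_le_sqrt (hCE s hs)) (by positivity)
  have hl2V : ∀ s ∈ Icc (-T) T, l2norm (V s) ^ 2 ≤ CE := fun s hs ↦ by
    have h1 := l2norm_cwd_sq_le_wordEnergy (k := 1) (v := ([] : List ι)) (by simp) (V s)
    rw [cwd_nil] at h1
    exact h1.trans (hCE s hs)
  -- Step 1: pointwise fundamental theorem of calculus
  have hptw : ∀ (y : EuclideanSpace ℝ ι) (τ : ℝ), ‖V τ y‖ ^ 2 = ∫ s in (0 : ℝ)..τ, F s y := by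
    intro y τ
    have hd : ∀ s, HasDerivAt (fun σ ↦ ‖V σ y‖ ^ 2) (F s y) s := fun s ↦ by
      have h1 := (hV.hasDerivAt s y).norm_sq
      exact h1
    have hc : Continuous fun s ↦ F s y := hFcont.comp (continuous_id.prodMk continuous_const)
    rw [integral_eq_sub_of_hasDerivAt (fun s _ ↦ hd s) (hc.intervalIntegrable _ _), h0 y]
    simp
  -- Step 2: integrability on `[0, τ] × ℝⁿ` for `0 ≤ τ ≤ T`
  have hdom : ∀ s y, ‖F s y‖ ≤ ‖V s y‖ ^ 2 + ‖P s y‖ ^ 2 := by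
    intro s y
    rw [hF, Real.norm_eq_abs, abs_mul, abs_two]
    have h1 := abs_real_inner_le_norm (V s y) (P s y)
    nlinarith [sq_nonneg (‖V s y‖ - ‖P s y‖), abs_nonneg ⟪V s y, P s y⟫]
  have hInt : ∀ τ ∈ Icc 0 T, Integrable (fun p : ℝ × EuclideanSpace ℝ ι ↦ F p.1 p.2)
      ((volume.restrict (Ioc 0 τ)).prod volume) := by
    intro τ hτ
    set μ : Measure ℝ := volume.restrict (Ioc 0 τ) with hμ
    haveI : IsFiniteMeasure μ := by rw [hμ]; infer_instance
    have hmeasF : AEStronglyMeasurable (fun p : ℝ × EuclideanSpace ℝ ι ↦ F p.1 p.2) (μ.prod volume) :=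
      hFcont.stronglyMeasurable.aestronglyMeasurable
    -- the dominating function `‖V‖² + ‖P‖²` has finite integral
    set Dm : ℝ × EuclideanSpace ℝ ι → ℝ := fun p ↦ ‖V p.1 p.2‖ ^ 2 + ‖P p.1 p.2‖ ^ 2 with hDm
    have hDmc : Continuous Dm := (hVcont.norm.pow 2).add (hPcont.norm.pow 2)
    have hbound : ∀ s ∈ Icc (-T) T, ∫⁻ y, ‖Dm (s, y)‖ₑ ≤
        ENNReal.ofReal (CE + ((Fintype.card ι + 1) * M * Real.sqrt CE) ^ 2) := by
      intro s hs
      have hnn : ∀ y, 0 ≤ Dm (s, y) := fun y ↦ by rw [hDm]; positivity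
      have h1 : ∫⁻ y, ‖Dm (s, y)‖ₑ = (∫⁻ y, ‖V s y‖ₑ ^ 2) + ∫⁻ y, ‖P s y‖ₑ ^ 2 := by
        have h2 : ∀ y, ‖Dm (s, y)‖ₑ = ‖V s y‖ₑ ^ 2 + ‖P s y‖ₑ ^ 2 := fun y ↦ by
          rw [Real.enorm_eq_ofReal (hnn y), hDm]
          simp only
          rw [ENNReal.ofReal_add (sq_nonneg _) (sq_nonneg _), ← ofReal_norm, ← ofReal_norm,
            ENNReal.ofReal_pow (norm_nonneg _), ENNReal.ofReal_pow (norm_nonneg _)]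
        simp_rw [h2]
        exact lintegral_add_left ((hV.smooth s).continuous.enorm.measurable.pow_const _) _
      rw [h1, lintegral_enorm_sq_eq_ofReal_l2norm_sq (hVmem s),
        lintegral_enorm_sq_eq_ofReal_l2norm_sq (hPmem s hs).1, ← ENNReal.ofReal_add (sq_nonneg _) (sq_nonneg _)]
      refine ENNReal.ofReal_le_ofReal (add_le_add (hl2V s hs) ?_)
      exact pow_le_pow_left₀ (l2norm_nonneg _) (hPmem s hs).2 2
    have hDint : Integrable Dm (μ.prod volume) := by
      refine ⟨hDmc.stronglyMeasurable.aestronglyMeasurable, ?_⟩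
      rw [HasFiniteIntegral]
      calc ∫⁻ p, ‖Dm p‖ₑ ∂(μ.prod volume) ≤ ∫⁻ s, ∫⁻ y, ‖Dm (s, y)‖ₑ ∂volume ∂μ := lintegral_prod_le _
        _ ≤ ∫⁻ _s, ENNReal.ofReal (CE + ((Fintype.card ι + 1) * M * Real.sqrt CE) ^ 2) ∂μ := by
            refine lintegral_mono_ae ?_
            rw [hμ, ae_restrict_iff' measurableSet_Ioc]
            exact Eventually.of_forall fun s hs ↦ hbound s ⟨by linarith [hs.1], hs.2.trans hτ.2⟩
        _ < ⊤ := by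
            rw [lintegral_const]
            exact ENNReal.mul_lt_top ENNReal.ofReal_lt_top (measure_lt_top _ _)
    exact hDint.mono' hmeasF (Eventually.of_forall fun p ↦ hdom p.1 p.2)
  -- Step 3: the energy `e` and its integral representation
  set e : ℝ → ℝ := fun s ↦ l2norm (V s) ^ 2 with he
  set phi : ℝ → ℝ := fun s ↦ ∫ y, F s y with hphi
  have hphimeas : StronglyMeasurable phi :=
    hFcont.stronglyMeasurable.integral_prod_right' (ν := (volume : Measure (EuclideanSpace ℝ ι)))
  have he_eq : ∀ τ ∈ Icc 0 T, e τ = ∫ s in (0 : ℝ)..τ, phi s := by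
    intro τ hτ
    rw [he]
    simp only
    rw [← integral_norm_sq_eq_l2norm_sq (hVmem τ)]
    simp_rw [hptw _ τ, intervalIntegral.integral_of_le hτ.1]
    exact integral_integral_swap ((hInt τ hτ).swap)
  -- Step 4: the differential inequality in integral form
  set K : ℝ := 2 * ((Fintype.card ι + 1) * 2 * M) with hK
  have hK0 : 0 ≤ K := by positivity
  have hphile : ∀ s ∈ Icc (-T) T, |phi s| ≤ K * e s := by
    intro s hs
    have h1 := abs_integral_inner_cwd_foOp_le (hM s hs) (hV.isHkSmooth s) (v := []) le_rfl
    simp only [cwd_nil, zero_add, pow_one] at h1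
    rw [wordEnergy_zero] at h1
    rw [hphi, hF]
    simp only
    rw [MeasureTheory.integral_const_mul, abs_mul, abs_two, hK, he]
    simp only
    nlinarith [h1]
  have hebdd : ∀ s ∈ Icc (-T) T, e s ≤ CE := fun s hs ↦ hl2V s hs
  have he0 : ∀ s, 0 ≤ e s := fun s ↦ sq_nonneg _
  have hemeas : StronglyMeasurable e := by
    have h1 : e = fun s ↦ ∫ y, ‖V s y‖ ^ 2 := funext fun s ↦ (integral_norm_sq_eq_l2norm_sq (hVmem s)).symm
    rw [h1]
    exact (hVcont.norm.pow 2).stronglyMeasurable.integral_prod_right'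
      (ν := (volume : Measure (EuclideanSpace ℝ ι)))
  -- interval integrability of `phi` on `[0, τ] ⊆ [0, T]`
  have hphiii : ∀ τ ∈ Icc 0 T, IntervalIntegrable phi volume 0 τ := by
    intro τ hτ
    rw [intervalIntegrable_iff_integrableOn_Ioc_of_le hτ.1]
    refine Integrable.mono' (integrable_const (K * CE)) hphimeas.aestronglyMeasurable.restrict ?_
    rw [ae_restrict_iff' measurableSet_Ioc]
    refine Eventually.of_forall fun s hs ↦ ?_
    have hs' : s ∈ Icc (-T) T := ⟨by linarith [hs.1], hs.2.trans hτ.2⟩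
    rw [Real.norm_eq_abs]
    exact (hphile s hs').trans (mul_le_mul_of_nonneg_left (hebdd s hs') hK0)
  -- Step 5: Grönwall in integral form, `e τ ≤ CE (Kτ)ⁿ / n!`
  have hiter : ∀ n : ℕ, ∀ τ ∈ Icc 0 T, e τ ≤ CE * (K * τ) ^ n / n ! := by
    intro n
    induction n with
    | zero =>
      intro τ hτ
      simpa using hebdd τ ⟨by linarith [hτ.1], hτ.2⟩
    | succ n ih =>
      intro τ hτ
      have hg : Continuous fun s : ℝ ↦ K * (CE * (K * s) ^ n / n !) := by fun_prop
      calc e τ = ∫ s in (0 : ℝ)..τ, phi s := he_eq τ hτ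
        _ ≤ ∫ s in (0 : ℝ)..τ, K * (CE * (K * s) ^ n / n !) := by
            refine intervalIntegral.integral_mono_on hτ.1 (hphiii τ hτ) (hg.intervalIntegrable _ _)
              fun s hs ↦ ?_
            have hs' : s ∈ Icc (-T) T := ⟨by linarith [hs.1], hs.2.trans hτ.2⟩
            exact ((le_abs_self _).trans (hphile s hs')).trans
              (mul_le_mul_of_nonneg_left (ih s ⟨hs.1, hs.2.trans hτ.2⟩) hK0)
        _ = CE * (K * τ) ^ (n + 1) / (n + 1)! := by
            have h1 : (fun s : ℝ ↦ K * (CE * (K * s) ^ n / n !)) =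
                fun s ↦ (K * CE * K ^ n / n !) * s ^ n := by
              funext s; rw [mul_pow]; ring
            rw [h1, intervalIntegral.integral_const_mul, integral_pow, Nat.factorial_succ]
            push_cast
            have hn : (n ! : ℝ) ≠ 0 := by positivity
            have hn1 : ((n : ℝ) + 1) ≠ 0 := by positivity
            field_simp
            ring
  -- hence `e t = 0`
  have htT : t ∈ Icc 0 T := ⟨ht, by linarith⟩
  have het : e t = 0 := by
    have hlim : Tendsto (fun n : ℕ ↦ CE * (K * t) ^ n / n !) atTop (𝓝 0) := by
      have h1 := (FloorSemiring.tendsto_pow_div_factorial_atTop (K * t)).const_mul CE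
      rw [mul_zero] at h1
      refine h1.congr fun n ↦ ?_
      ring
    have hle : e t ≤ 0 := ge_of_tendsto' hlim fun n ↦ hiter n t htT
    exact le_antisymm hle (he0 t)
  -- Step 6: `V t = 0` pointwise
  have hint0 : ∫ y, ‖V t y‖ ^ 2 = 0 := by rw [integral_norm_sq_eq_l2norm_sq (hVmem t)]; exact het
  have hnn : 0 ≤ fun y ↦ ‖V t y‖ ^ 2 := fun y ↦ sq_nonneg _
  have hintg : Integrable (fun y ↦ ‖V t y‖ ^ 2) (volume : Measure (EuclideanSpace ℝ ι)) :=
    (hVmem t).integrable_norm_pow two_ne_zero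
  have hae := (integral_eq_zero_iff_of_nonneg hnn hintg).1 hint0
  have hcont : Continuous fun y ↦ ‖V t y‖ ^ 2 := ((hV.smooth t).continuous.norm.pow 2)
  have hzero : (fun y ↦ ‖V t y‖ ^ 2) = 0 := (hcont.ae_eq_iff_eq volume continuous_const).1 hae
  have := congrFun hzero x
  simp only [Pi.zero_apply, ne_eq, OfNat.ofNat_ne_zero, not_false_eq_true, pow_eq_zero_iff,
    norm_eq_zero] at this
  exact this

end Forward

/-! ### Uniqueness -/

section Main

variable {A : ι → ℝ → EuclideanSpace ℝ ι → (W →L[ℝ] W)} {B : ℝ → EuclideanSpace ℝ ι → (W →L[ℝ] W)}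
variable {V : ℝ → EuclideanSpace ℝ ι → W}

/-- **Uniqueness of finite-energy classical solutions** (Friedrichs 1954, §2; Lax 2006, §6.2): for
symmetric coefficients admissible of order `0` on time slabs and jointly continuous, a
finite-energy classical solution with `V(0) = 0` vanishes identically.
[cite: Friedrichs1954, §2] -/
theorem eq_zero_of_isEnergySol
    (hcoeff : ∀ T : ℝ, ∃ M : ℝ, ∀ t ∈ Icc (-T) T, IsSymmCoeff 0 M (fun j ↦ A j t) (B t))
    (hAc : ∀ j, Continuous fun p : ℝ × EuclideanSpace ℝ ι ↦ A j p.1 p.2)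
    (hBc : Continuous fun p : ℝ × EuclideanSpace ℝ ι ↦ B p.1 p.2)
    (hV : IsEnergySol A B V) (h0 : ∀ x, V 0 x = 0) (t : ℝ) (x : EuclideanSpace ℝ ι) :
    V t x = 0 := by
  by_cases ht : 0 ≤ t
  · exact eq_zero_of_isEnergySol_of_nonneg hcoeff hAc hBc hV h0 ht x
  · -- time reversal
    have ht' : 0 ≤ -t := by linarith
    have hcoeff' : ∀ T : ℝ, ∃ M : ℝ, ∀ s ∈ Icc (-T) T,
        IsSymmCoeff 0 M (fun j ↦ (fun j s y ↦ -A j (-s) y) j s) ((fun s y ↦ -B (-s) y) s) := by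
      intro T
      obtain ⟨M, hM⟩ := hcoeff T
      exact ⟨M, fun s hs ↦ (hM (-s) ⟨by linarith [hs.2], by linarith [hs.1]⟩).neg⟩
    have hAc' : ∀ j, Continuous fun p : ℝ × EuclideanSpace ℝ ι ↦ (fun j s y ↦ -A j (-s) y) j p.1 p.2 :=
      fun j ↦ ((hAc j).comp (continuous_fst.neg.prodMk continuous_snd)).neg
    have hBc' : Continuous fun p : ℝ × EuclideanSpace ℝ ι ↦ (fun s y ↦ -B (-s) y) p.1 p.2 :=
      (hBc.comp (continuous_fst.neg.prodMk continuous_snd)).neg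
    have h1 := eq_zero_of_isEnergySol_of_nonneg hcoeff' hAc' hBc' hV.reverse (by simpa using h0) ht' x
    simpa using h1

end Main

end Literature.Analysis.PDE

end
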